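import Literature.NumberTheory.LFunctions.RayClassLSeriesLogDerivLocal
import Literature.NumberTheory.LFunctions.RayClassLSeriesNonvanishingLineProofs
import Literature.NumberTheory.LFunctions.ClassGroupLFunctionStripBounds
import Literature.NumberTheory.LFunctions.ExplicitFormulaPsiCharLogDeriv
import HarnessLib

/-!
# `L'/L(s, χ)` in the strip `−1/2 ≤ σ ≤ 3/2` at good heights for Hecke `L`-series of primitive ray class
# characters, uniformly in the field and the modulus

Topic `Literature/NumberTheory/LFunctions`; namespace `Literature.NumberTheory.LFunctions`.  Pure-proof
companion of `RayClassLSeriesLogDerivLocal.lean` and `RayClassFunctionalEquation.lean`; the ray-class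
analogue (conductor `𝔣 = 𝔪`) of `ClassGroupLFunctionStripBounds.lean` (Montgomery–Vaughan Lemmas 12.6–12.8
over a number field).  Everything here is PROVED; no definition and no named fact is introduced.

For a primitive ray class character `χ mod 𝔪 ≠ 0` of sign type `p`, non-principal on the ideals prime to `𝔪`,
entire continuations `L`, `L̄` of `L(χ, ·)`, `L(χ̄, ·)`, `A = |d_K| 𝔑𝔪`, `L_∞ = rayClassGammaFactor K p` and
`M(t) = log A + 3 n_K + n_K log(|t| + 7)`:

* `completed_continuation_functional_equation` — `A^{w/2} L_∞(w) L(w) = W · A^{(1−w)/2} L_∞(1−w) L̄(1−w)`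
  for every `w ∉ ℤ`, `|W| = 1` (Hecke's functional equation transported to the entire continuations);
* `logDeriv_continuation_reflect` — `L'/L(w) = −log A − L_∞'/L_∞(w) − L_∞'/L_∞(1−w) − L̄'/L̄(1−w)` for
  `w ∉ ℤ` with `L̄(1 − w) ≠ 0`;
* `norm_logDeriv_rayClassGammaFactor_le` — `‖L_∞'/L_∞(σ+it)‖ ≤ n_K (log(|t|+4) + 11)`, `−1/2 ≤ σ ≤ 3/2`, `|t| ≥ 2`;
* `norm_logDeriv_continuation_le_of_dist` — on `1/4 ≤ σ ≤ 3/2`, if the zeros of `L` with `0 < β < 1` are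
  `η`-separated from `t` (`0 < η ≤ 1`): `L(σ+it) ≠ 0`, `‖L'/L(σ+it)‖ ≤ 78000 · M(t)/η`;
* `norm_logDeriv_continuation_le_strip` — on `−1/2 ≤ σ ≤ 3/2`, `|t| ≥ 2`, with the zeros of `L̄` also
  `η`-separated from `−t`: `L(σ+it) ≠ 0`, `‖L'/L(σ+it)‖ ≤ 80000 · M(t)/η`.

## References

* H. L. Montgomery, R. C. Vaughan, *Multiplicative Number Theory I*, CUP 2007, Lemmas 12.6–12.8.
  [MontgomeryVaughan2007]
* J. Neukirch, *Algebraic Number Theory*, Springer 1999, Ch. VII §8, (8.5)–(8.6). [NeukirchANT1999]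
* J. C. Lagarias, A. M. Odlyzko, in *Algebraic Number Fields* (1977), §§5–6. [LagariasOdlyzko1977]
-/

noncomputable section

open Complex NumberField NumberField.InfinitePlace NumberField.Units IsDedekindDomain Filter Topology Set Metric
  Finset
open scoped NumberField nonZeroDivisors Real
open scoped Classical

namespace Literature.NumberTheory.LFunctions

open Literature.NumberTheory.LFunctions.LogFreeLocal

variable {K : Type*} [Field K] [NumberField K]
variable {𝔪 : Ideal (𝓞 K)} {ψ : HeightOneSpectrum (𝓞 K) → ℂ} {p : Finset {w : InfinitePlace K // IsReal w}}

/-! ### Bookkeeping off the integers -/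

omit [NumberField K] in
/-- The character `χ̄` is also non-principal on the ideals prime to `𝔪`. [folklore] -/
private theorem star_nontrivial' (hnt : ∃ v : HeightOneSpectrum (𝓞 K), ¬ 𝔪 ≤ v.asIdeal ∧ ψ v ≠ 1) :
    ∃ v : HeightOneSpectrum (𝓞 K), ¬ 𝔪 ≤ v.asIdeal ∧ star ψ v ≠ 1 := by
  obtain ⟨v, hv, hv1⟩ := hnt
  refine ⟨v, hv, fun h ↦ hv1 ?_⟩
  have := congrArg star h
  simpa using this

omit [NumberField K] in
/-- `s + c ∉ ℤ` for `s ∉ ℤ`, `c ∈ ℤ`. [folklore] -/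
private theorem add_intCast_ne_int {s : ℂ} (hs : ∀ n : ℤ, s ≠ n) (c : ℤ) : ∀ n : ℤ, s + c ≠ n :=
  fun n h ↦ hs (n - c) (by push_cast; linear_combination h)

omit [NumberField K] in
/-- `s/2` is not a pole of `Γ` for `s ∉ ℤ`. [folklore] -/
private theorem half_ne_neg_nat_of_ne_int {s : ℂ} (hs : ∀ n : ℤ, s ≠ n) : ∀ m : ℕ, s / 2 ≠ -m :=
  fun m h ↦ hs (-(2 * m)) (by push_cast; linear_combination 2 * h)

omit [NumberField K] in
/-- `2 · (half weight) ∈ {0, 1}`. [folklore] -/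
private theorem exists_two_mul_halfWeight_eq (w : {w : InfinitePlace K // IsReal w}) :
    ∃ c : ℤ, (c = 0 ∨ c = 1) ∧ (2 * (NumberField.halfWeight K p w.1 : ℂ)) = (c : ℂ) := by
  unfold NumberField.halfWeight
  rw [dif_pos w.2]
  split_ifs
  · exact ⟨1, Or.inr rfl, by push_cast; ring⟩
  · exact ⟨0, Or.inl rfl, by push_cast; ring⟩

/-- The product form of `L_∞`. [folklore] -/
private theorem rayClassGammaFactor_eq_fun (p : Finset {w : InfinitePlace K // IsReal w}) :
    rayClassGammaFactor K p = fun s ↦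
      (∏ w : {w : InfinitePlace K // IsReal w}, Gammaℝ (s + 2 * (NumberField.halfWeight K p w.1 : ℂ))) *
        ∏ _w : {w : InfinitePlace K // IsComplex w}, Gammaℂ s := by
  funext s; rw [rayClassGammaFactor]

omit [NumberField K] in
/-- Each real factor `Γ_ℝ(s + 2a_v)` is differentiable and non-zero at `s ∉ ℤ`. [folklore] -/
private theorem gammaℝ_shift_differentiableAt_ne_zero {s : ℂ} (hs : ∀ n : ℤ, s ≠ n)
    (w : {w : InfinitePlace K // IsReal w}) :
    DifferentiableAt ℂ (fun z : ℂ ↦ Gammaℝ (z + 2 * (NumberField.halfWeight K p w.1 : ℂ))) s ∧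
      Gammaℝ (s + 2 * (NumberField.halfWeight K p w.1 : ℂ)) ≠ 0 ∧
      DifferentiableAt ℂ Gammaℝ (s + 2 * (NumberField.halfWeight K p w.1 : ℂ)) := by
  obtain ⟨c, -, hc⟩ := exists_two_mul_halfWeight_eq (p := p) w
  have hsc : ∀ n : ℤ, s + 2 * (NumberField.halfWeight K p w.1 : ℂ) ≠ n := by
    rw [hc]; exact add_intCast_ne_int hs c
  have hd : DifferentiableAt ℂ Gammaℝ (s + 2 * (NumberField.halfWeight K p w.1 : ℂ)) :=
    (RealZeros.hasDerivAt_Gammaℝ (half_ne_neg_nat_of_ne_int hsc)).differentiableAt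
  refine ⟨hd.comp s (differentiableAt_id.add_const _), ?_, hd⟩
  rw [Ne, Gammaℝ_eq_zero_iff]
  rintro ⟨m, hm⟩
  exact hsc (-(2 * m)) (by rw [hm]; push_cast; ring)

omit [NumberField K] in
/-- `Γ_ℂ` is differentiable and non-zero at `s ∉ ℤ`. [folklore] -/
private theorem gammaℂ_differentiableAt_ne_zero {s : ℂ} (hs : ∀ n : ℤ, s ≠ n) :
    DifferentiableAt ℂ Gammaℂ s ∧ Gammaℂ s ≠ 0 := by
  have hsN : ∀ m : ℕ, s ≠ -m := NumberField.ne_neg_nat_of_ne_int hs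
  refine ⟨NumberField.differentiableAt_Gammaℂ hsN, ?_⟩
  rw [Gammaℂ_def]
  refine mul_ne_zero (mul_ne_zero two_ne_zero ?_) (Complex.Gamma_ne_zero hsN)
  rw [Ne, Complex.cpow_eq_zero_iff]
  exact fun h ↦ (mul_ne_zero two_ne_zero (by exact_mod_cast Real.pi_ne_zero)) h.1

/-- `L_∞` is differentiable and non-zero off the integers. [folklore] -/
private theorem rayClassGammaFactor_differentiableAt_ne_zero (p : Finset {w : InfinitePlace K // IsReal w})
    {s : ℂ} (hs : ∀ n : ℤ, s ≠ n) :
    DifferentiableAt ℂ (rayClassGammaFactor K p) s ∧ rayClassGammaFactor K p s ≠ 0 := by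
  rw [rayClassGammaFactor_eq_fun]
  obtain ⟨hℂd, hℂ0⟩ := gammaℂ_differentiableAt_ne_zero hs
  refine ⟨?_, ?_⟩
  · refine DifferentiableAt.mul (DifferentiableAt.fun_finsetProd fun w _ ↦
      (gammaℝ_shift_differentiableAt_ne_zero (p := p) hs w).1) (DifferentiableAt.fun_finsetProd fun _ _ ↦ hℂd)
  · exact mul_ne_zero (prod_ne_zero_iff.2 fun w _ ↦ (gammaℝ_shift_differentiableAt_ne_zero (p := p) hs w).2.1)
      (prod_ne_zero_iff.2 fun _ _ ↦ hℂ0)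

/-- **`L_∞'/L_∞(s) = Σ_{v real} Γ_ℝ'/Γ_ℝ(s + 2a_v) + r₂ Γ_ℂ'/Γ_ℂ(s)`** off the integers. [folklore] -/
private theorem logDeriv_rayClassGammaFactor {s : ℂ} (hs : ∀ n : ℤ, s ≠ n) :
    logDeriv (rayClassGammaFactor K p) s =
      ∑ w : {w : InfinitePlace K // IsReal w}, logDeriv Gammaℝ (s + 2 * (NumberField.halfWeight K p w.1 : ℂ)) +
        ∑ _w : {w : InfinitePlace K // IsComplex w}, logDeriv Gammaℂ s := by
  obtain ⟨hℂd, hℂ0⟩ := gammaℂ_differentiableAt_ne_zero hs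
  have hR := fun w ↦ gammaℝ_shift_differentiableAt_ne_zero (p := p) hs w
  rw [rayClassGammaFactor_eq_fun,
    logDeriv_mul (f := fun z ↦ ∏ w : {w : InfinitePlace K // IsReal w},
        Gammaℝ (z + 2 * (NumberField.halfWeight K p w.1 : ℂ)))
      (g := fun z ↦ ∏ _w : {w : InfinitePlace K // IsComplex w}, Gammaℂ z) s
      (prod_ne_zero_iff.2 fun w _ ↦ (hR w).2.1) (prod_ne_zero_iff.2 fun _ _ ↦ hℂ0)
      (DifferentiableAt.fun_finsetProd fun w _ ↦ (hR w).1) (DifferentiableAt.fun_finsetProd fun _ _ ↦ hℂd),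
    logDeriv_prod (s := univ) (f := fun (w : {w : InfinitePlace K // IsReal w}) (z : ℂ) ↦
        Gammaℝ (z + 2 * (NumberField.halfWeight K p w.1 : ℂ))) (x := s) (fun w _ ↦ (hR w).2.1)
      (fun w _ ↦ (hR w).1),
    logDeriv_prod (s := univ) (f := fun (_w : {w : InfinitePlace K // IsComplex w}) (z : ℂ) ↦ Gammaℂ z) (x := s)
      (fun _ _ ↦ hℂ0) (fun _ _ ↦ hℂd)]
  congr 1
  refine sum_congr rfl fun w _ ↦ ?_
  rw [logDeriv_apply, logDeriv_apply, deriv_comp_add_const]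

/-- **The gamma factor on horizontal segments** (Stirling): `‖L_∞'/L_∞(σ + it)‖ ≤ n_K (log(|t| + 4) + 11)`
for `−1/2 ≤ σ ≤ 3/2`, `|t| ≥ 2`. [cite: MontgomeryVaughan2007, Theorem C.1] -/
theorem norm_logDeriv_rayClassGammaFactor_le (p : Finset {w : InfinitePlace K // IsReal w}) {σ t : ℝ}
    (hσ1 : -(1 / 2) ≤ σ) (hσ2 : σ ≤ 3 / 2) (ht : 2 ≤ |t|) :
    ‖logDeriv (rayClassGammaFactor K p) (σ + t * I)‖ ≤ Module.finrank ℚ K * (Real.log (|t| + 4) + 11) := by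
  have ht0 : t ≠ 0 := fun h ↦ by rw [h, abs_zero] at ht; linarith
  have hsZ : ∀ n : ℤ, (σ + t * I : ℂ) ≠ n := NumberField.ne_int_of_im_ne_zero (by simpa using ht0)
  rw [logDeriv_rayClassGammaFactor hsZ]
  have hl0 : 0 ≤ Real.log (|t| + 4) := Real.log_nonneg (by linarith [abs_nonneg t])
  have hRe : ∀ w : {w : InfinitePlace K // IsReal w},
      ‖logDeriv Gammaℝ (σ + t * I + 2 * (NumberField.halfWeight K p w.1 : ℂ))‖ ≤ Real.log (|t| + 4) + 11 := by
    intro w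
    obtain ⟨c, hc01, hc⟩ := exists_two_mul_halfWeight_eq (p := p) w
    have hc0 : (0 : ℝ) ≤ c ∧ (c : ℝ) ≤ 1 := by
      rcases hc01 with h | h <;> simp [h]
    have e : (σ + t * I + 2 * (NumberField.halfWeight K p w.1 : ℂ) : ℂ) = ((σ + c : ℝ) : ℂ) + t * I := by
      rw [hc]; push_cast; ring
    rw [e]
    have h := ExplicitPsiChar.norm_logDeriv_Gammaℝ_le_of_mem_Icc (σ := σ + c) (t := t) (by linarith)
      (by linarith) ht
    linarith
  have hCo : ∀ _w : {w : InfinitePlace K // IsComplex w}, ‖logDeriv Gammaℂ (σ + t * I)‖ ≤ Real.log (|t| + 4) + 11 :=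
    fun _ ↦ NumberField.norm_logDeriv_Gammaℂ_le' hσ1 (by linarith) ht
  have hrank : ((univ : Finset {w : InfinitePlace K // IsReal w}).card : ℝ) +
      ((univ : Finset {w : InfinitePlace K // IsComplex w}).card : ℝ) ≤ Module.finrank ℚ K := by
    have h := card_add_two_mul_card_eq_rank K
    rw [nrRealPlaces, nrComplexPlaces] at h
    rw [card_univ, card_univ]
    have : ((Fintype.card {w : InfinitePlace K // IsReal w} : ℕ) : ℝ) +
        2 * (Fintype.card {w : InfinitePlace K // IsComplex w} : ℕ) = Module.finrank ℚ K := by exact_mod_cast h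
    linarith [(Fintype.card {w : InfinitePlace K // IsComplex w}).cast_nonneg (α := ℝ)]
  calc ‖∑ w : {w : InfinitePlace K // IsReal w}, logDeriv Gammaℝ (σ + t * I + 2 * (NumberField.halfWeight K p w.1 : ℂ)) +
        ∑ _w : {w : InfinitePlace K // IsComplex w}, logDeriv Gammaℂ (σ + t * I)‖
      ≤ ∑ w : {w : InfinitePlace K // IsReal w}, ‖logDeriv Gammaℝ (σ + t * I + 2 * (NumberField.halfWeight K p w.1 : ℂ))‖ +
        ∑ _w : {w : InfinitePlace K // IsComplex w}, ‖logDeriv Gammaℂ (σ + t * I)‖ :=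
        (norm_add_le _ _).trans (add_le_add (norm_sum_le _ _) (norm_sum_le _ _))
    _ ≤ ∑ _w : {w : InfinitePlace K // IsReal w}, (Real.log (|t| + 4) + 11) +
        ∑ _w : {w : InfinitePlace K // IsComplex w}, (Real.log (|t| + 4) + 11) :=
        add_le_add (sum_le_sum fun w _ ↦ hRe w) (sum_le_sum fun w _ ↦ hCo w)
    _ = (((univ : Finset {w : InfinitePlace K // IsReal w}).card : ℝ) +
        ((univ : Finset {w : InfinitePlace K // IsComplex w}).card : ℝ)) * (Real.log (|t| + 4) + 11) := by
        rw [sum_const, sum_const, nsmul_eq_mul, nsmul_eq_mul]; ring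
    _ ≤ Module.finrank ℚ K * (Real.log (|t| + 4) + 11) := by
        exact mul_le_mul_of_nonneg_right hrank (by linarith)

/-! ### The functional equation between the two continuations -/

/-- `Λ₁(w) = A^{w/2} L_∞(w) L₁(w)` off the integers, for the continuation `Λ₁` of a completed `L`-series from
Hecke's functional equation and any entire continuation `L₁` of the same `L`-series (identity theorem on
`ℂ ∖ ℤ`). [folklore] -/
private theorem completed_eq_of_ne_int' (h𝔪 : 𝔪 ≠ ⊥) {ψ₁ : HeightOneSpectrum (𝓞 K) → ℂ} {Λ₁ L₁ : ℂ → ℂ}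
    (hΛd : DifferentiableOn ℂ Λ₁ ({0, 1}ᶜ : Set ℂ))
    (hΛ : ∀ s : ℂ, 1 < s.re → Λ₁ s = completedRayClassL K 𝔪 ψ₁ p s)
    (hL : Differentiable ℂ L₁) (hLs : ∀ s : ℂ, 1 < s.re → L₁ s = rayClassLSeries 𝔪 ψ₁ s)
    {w : ℂ} (hw : ∀ n : ℤ, w ≠ n) :
    Λ₁ w = (((|(discr K : ℝ)| * (Ideal.absNorm 𝔪 : ℝ) : ℝ)) : ℂ) ^ (w / 2) * rayClassGammaFactor K p w * L₁ w := by
  set V : Set ℂ := {z : ℂ | ∀ n : ℤ, z ≠ n} with hV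
  have hVo : IsOpen V := NumberField.isOpen_compl_int
  have hVeq : V = (Set.range (fun n : ℤ ↦ (n : ℂ)))ᶜ := by
    ext z; simp only [hV, Set.mem_setOf_eq, Set.mem_compl_iff, Set.mem_range, not_exists]
    exact ⟨fun h n hn ↦ h n hn.symm, fun h n hn ↦ h n hn.symm⟩
  have hVc : IsPreconnected V := by
    rw [hVeq]
    exact ((Set.countable_range _).isPathConnected_compl_of_one_lt_rank
      (Complex.rank_real_complex ▸ Nat.one_lt_ofNat)).isConnected.isPreconnected
  have hVsub : V ⊆ ({0, 1}ᶜ : Set ℂ) := by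
    intro z hz h01
    rcases h01 with h | h
    · exact hz 0 (by simpa using h)
    · exact hz 1 (by simpa using h)
  have hA0 : ((((|(discr K : ℝ)| * (Ideal.absNorm 𝔪 : ℝ) : ℝ)) : ℂ)) ≠ 0 := by
    have hd : 0 < |(discr K : ℝ)| := abs_pos.mpr (by exact_mod_cast discr_ne_zero K)
    have hm : (0 : ℝ) < Ideal.absNorm 𝔪 := by
      exact_mod_cast Nat.pos_of_ne_zero (by rwa [ne_eq, Ideal.absNorm_eq_zero_iff])
    exact Complex.ofReal_ne_zero.mpr (by positivity)
  set F : ℂ → ℂ := fun z ↦ (((|(discr K : ℝ)| * (Ideal.absNorm 𝔪 : ℝ) : ℝ)) : ℂ) ^ (z / 2) *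
    rayClassGammaFactor K p z * L₁ z with hF
  have hγV : DifferentiableOn ℂ (rayClassGammaFactor K p) V :=
    fun z hz ↦ (rayClassGammaFactor_differentiableAt_ne_zero p hz).1.differentiableWithinAt
  have hFa : AnalyticOnNhd ℂ F V := by
    intro z hz
    refine ((AnalyticAt.mul ?_ (hγV.analyticAt (hVo.mem_nhds hz))).mul
      ((hL.differentiableOn.analyticOnNhd isOpen_univ) z (Set.mem_univ _)))
    refine (DifferentiableOn.analyticAt (s := Set.univ) ?_ Filter.univ_mem)
    intro y _
    exact ((differentiableAt_id.div_const 2).const_cpow (Or.inl hA0)).differentiableWithinAt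
  have hΛa : AnalyticOnNhd ℂ Λ₁ V := (hΛd.mono hVsub).analyticOnNhd hVo
  have h32 : ((3 / 2 : ℝ) : ℂ) ∈ V := by
    intro n hn
    have := congrArg Complex.re hn
    simp at this
    have h2 : (2 * n : ℤ) = 3 := by exact_mod_cast (by linarith : (2 * n : ℝ) = 3)
    omega
  have heq := AnalyticOnNhd.eqOn_of_preconnected_of_eventuallyEq hΛa hFa hVc h32 ?_
  · exact heq hw
  · refine eventually_of_mem ((continuous_re.isOpen_preimage _ isOpen_Ioi).mem_nhds
      (by rw [Set.mem_preimage, Complex.ofReal_re]; norm_num)) fun z (hz : 1 < z.re) ↦ ?_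
    show Λ₁ z = F z
    rw [hF]
    dsimp only
    rw [hΛ z hz, completedRayClassL, hLs z hz]

/-- **Hecke's functional equation between the entire continuations**: there is `W`, `|W| = 1`, with
`A^{w/2} L_∞(w) L(w) = W · A^{(1−w)/2} L_∞(1−w) L̄(1−w)` for every `w ∉ ℤ` (`A = |d_K| 𝔑𝔪`).
[cite: NeukirchANT1999, Ch. VII §8 (8.6) Corollary] -/
theorem completed_continuation_functional_equation (hψ : IsRayClassCharacter 𝔪 ψ) (hprim : IsPrimitive 𝔪 ψ)
    (hp : IsSignType 𝔪 ψ p) (h𝔪 : 𝔪 ≠ ⊥) {L L' : ℂ → ℂ} (hL : Differentiable ℂ L)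
    (hLs : ∀ s : ℂ, 1 < s.re → L s = rayClassLSeries 𝔪 ψ s) (hL' : Differentiable ℂ L')
    (hL's : ∀ s : ℂ, 1 < s.re → L' s = rayClassLSeries 𝔪 (star ψ) s) :
    ∃ W : ℂ, ‖W‖ = 1 ∧ ∀ w : ℂ, (∀ n : ℤ, w ≠ n) →
      (((|(discr K : ℝ)| * (Ideal.absNorm 𝔪 : ℝ) : ℝ)) : ℂ) ^ (w / 2) * rayClassGammaFactor K p w * L w =
        W * ((((|(discr K : ℝ)| * (Ideal.absNorm 𝔪 : ℝ) : ℝ)) : ℂ) ^ ((1 - w) / 2) *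
          rayClassGammaFactor K p (1 - w) * L' (1 - w)) := by
  obtain ⟨W, Λ, Λ', hW, -, -, hΛd, hΛ'd, hΛ, hΛ', hfe⟩ := rayClassLSeries_functional_equation' hψ hprim hp h𝔪
  refine ⟨W, hW, fun w hw ↦ ?_⟩
  rw [← completed_eq_of_ne_int' (p := p) h𝔪 hΛd hΛ hL hLs hw,
    ← completed_eq_of_ne_int' (p := p) h𝔪 hΛ'd hΛ' hL' hL's (NumberField.one_sub_ne_int hw)]
  have := hfe (1 - w)
  rwa [sub_sub_cancel] at this

/-- `(A^{z/2} L_∞(z))'/(A^{z/2} L_∞(z)) = ½ log A + L_∞'/L_∞(z)` off the integers. [folklore] -/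
private theorem logDeriv_completedGamma (p : Finset {w : InfinitePlace K // IsReal w}) {A : ℝ} (hA : 0 < A)
    {z : ℂ} (hz : ∀ n : ℤ, z ≠ n) :
    logDeriv (fun s ↦ ((A : ℝ) : ℂ) ^ (s / 2) * rayClassGammaFactor K p s) z =
      (Real.log A : ℂ) / 2 + logDeriv (rayClassGammaFactor K p) z := by
  have hA0 : ((A : ℝ) : ℂ) ≠ 0 := Complex.ofReal_ne_zero.mpr hA.ne'
  have hpow0 : ((A : ℝ) : ℂ) ^ (z / 2) ≠ 0 := by rw [Ne, cpow_eq_zero_iff, not_and_or]; exact Or.inl hA0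
  obtain ⟨hγd, hγ0⟩ := rayClassGammaFactor_differentiableAt_ne_zero p hz
  have h1 : DifferentiableAt ℂ (fun s : ℂ ↦ ((A : ℝ) : ℂ) ^ (s / 2)) z :=
    (differentiableAt_id.div_const 2).const_cpow (Or.inl hA0)
  rw [logDeriv_mul (f := fun s : ℂ ↦ ((A : ℝ) : ℂ) ^ (s / 2)) (g := rayClassGammaFactor K p) z hpow0 hγ0 h1 hγd]
  have hd : HasDerivAt (fun s : ℂ ↦ ((A : ℝ) : ℂ) ^ (s / 2))
      (((A : ℝ) : ℂ) ^ (z / 2) * Complex.log ((A : ℝ) : ℂ) * (1 / 2)) z := by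
    have := ((hasDerivAt_id z).div_const 2).const_cpow (c := ((A : ℝ) : ℂ)) (Or.inl hA0)
    simpa using this
  rw [logDeriv_apply, hd.deriv, ← Complex.ofReal_log hA.le]
  field_simp [hpow0]

/-- **`L'/L(w) = −log A − L_∞'/L_∞(w) − L_∞'/L_∞(1 − w) − L̄'/L̄(1 − w)`** for `w ∉ ℤ` with `L̄(1 − w) ≠ 0`
(and then `L(w) ≠ 0`): the functional equation, logarithmically differentiated.
[cite: MontgomeryVaughan2007, Lemma 12.8] -/
theorem logDeriv_continuation_reflect (hψ : IsRayClassCharacter 𝔪 ψ) (hprim : IsPrimitive 𝔪 ψ)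
    (hp : IsSignType 𝔪 ψ p) (h𝔪 : 𝔪 ≠ ⊥) {L L' : ℂ → ℂ} (hL : Differentiable ℂ L)
    (hLs : ∀ s : ℂ, 1 < s.re → L s = rayClassLSeries 𝔪 ψ s) (hL' : Differentiable ℂ L')
    (hL's : ∀ s : ℂ, 1 < s.re → L' s = rayClassLSeries 𝔪 (star ψ) s)
    {w : ℂ} (hwZ : ∀ n : ℤ, w ≠ n) (hL'w : L' (1 - w) ≠ 0) :
    L w ≠ 0 ∧
      logDeriv L w = -(Real.log (|(discr K : ℝ)| * (Ideal.absNorm 𝔪 : ℝ)) : ℂ) -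
        logDeriv (rayClassGammaFactor K p) w - logDeriv (rayClassGammaFactor K p) (1 - w) -
          logDeriv L' (1 - w) := by
  obtain ⟨W, hW, hFE⟩ := completed_continuation_functional_equation hψ hprim hp h𝔪 hL hLs hL' hL's
  set A : ℝ := |(discr K : ℝ)| * (Ideal.absNorm 𝔪 : ℝ) with hA
  have hApos : 0 < A := by
    have hd : 0 < |(discr K : ℝ)| := abs_pos.mpr (by exact_mod_cast discr_ne_zero K)
    have hm : (0 : ℝ) < Ideal.absNorm 𝔪 := by
      exact_mod_cast Nat.pos_of_ne_zero (by rwa [ne_eq, Ideal.absNorm_eq_zero_iff])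
    positivity
  have hA0 : ((A : ℝ) : ℂ) ≠ 0 := Complex.ofReal_ne_zero.mpr hApos.ne'
  have hW0 : W ≠ 0 := fun h ↦ by rw [h, norm_zero] at hW; exact zero_ne_one hW
  set s₀ : ℂ := 1 - w with hs₀
  have hws : w = 1 - s₀ := by rw [hs₀]; ring
  have hs₀Z : ∀ n : ℤ, s₀ ≠ n := NumberField.one_sub_ne_int hwZ
  -- the completed gamma factor `G(z) = A^{z/2} L_∞(z)`
  set G : ℂ → ℂ := fun z ↦ ((A : ℝ) : ℂ) ^ (z / 2) * rayClassGammaFactor K p z with hG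
  have hGd : ∀ {z : ℂ}, (∀ n : ℤ, z ≠ n) → DifferentiableAt ℂ G z := fun hz ↦
    ((differentiableAt_id.div_const 2).const_cpow (Or.inl hA0)).mul
      (rayClassGammaFactor_differentiableAt_ne_zero p hz).1
  have hG0 : ∀ {z : ℂ}, (∀ n : ℤ, z ≠ n) → G z ≠ 0 := fun hz ↦ by
    refine mul_ne_zero ?_ (rayClassGammaFactor_differentiableAt_ne_zero p hz).2
    rw [Ne, cpow_eq_zero_iff, not_and_or]; exact Or.inl hA0
  have hγw : DifferentiableAt ℂ G w := hGd hwZ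
  have hγs : DifferentiableAt ℂ G s₀ := hGd hs₀Z
  have hγw0 : G w ≠ 0 := hG0 hwZ
  have hγs0 : G s₀ ≠ 0 := hG0 hs₀Z
  have hLw : DifferentiableAt ℂ L w := hL w
  have hLs0 : DifferentiableAt ℂ L' s₀ := hL' s₀
  -- the functional equation near `s₀`: `G(1-s) L(1-s) = W G(s) L̄(s)`
  set F : ℂ → ℂ := fun s ↦ G (1 - s) * L (1 - s) with hF
  set H : ℂ → ℂ := fun s ↦ W * (G s * L' s) with hH
  have hFH : F =ᶠ[𝓝 s₀] H := by
    filter_upwards [NumberField.isOpen_compl_int.mem_nhds hs₀Z] with s hs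
    have h := hFE (1 - s) (NumberField.one_sub_ne_int hs)
    simp only [sub_sub_cancel] at h
    simp only [hF, hH, hG]
    linear_combination h
  have hFs : F s₀ = G w * L w := by simp only [hF, hws]
  have hHs : H s₀ = W * (G s₀ * L' s₀) := rfl
  have hFH0 : F s₀ = H s₀ := hFH.eq_of_nhds
  have hΛw0 : G w * L w ≠ 0 := by
    rw [← hFs, hFH0, hHs]; exact mul_ne_zero hW0 (mul_ne_zero hγs0 hL'w)
  have hLw0 : L w ≠ 0 := fun h ↦ hΛw0 (by rw [h, mul_zero])
  refine ⟨hLw0, ?_⟩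
  have hΛ : DifferentiableAt ℂ (fun z ↦ G z * L z) w := hγw.mul hLw
  have hdF : deriv F s₀ = -deriv (fun z ↦ G z * L z) w := by
    have hcomp : F = (fun z ↦ G z * L z) ∘ (fun s ↦ 1 - s) := rfl
    have h1 : HasDerivAt (fun s : ℂ ↦ 1 - s) (-1) s₀ := by
      simpa using (hasDerivAt_id s₀).const_sub 1
    have hΛ' : DifferentiableAt ℂ (fun z ↦ G z * L z) (1 - s₀) := by rw [← hws]; exact hΛ
    rw [hcomp, deriv_comp s₀ hΛ' h1.differentiableAt, h1.deriv, ← hws]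
    ring
  have hdH : deriv H s₀ = W * deriv (fun z ↦ G z * L' z) s₀ := by
    simp only [hH]
    exact deriv_const_mul W (hγs.mul hLs0)
  have hdFH : deriv F s₀ = deriv H s₀ := hFH.deriv_eq
  have hlogΛ : logDeriv (fun z ↦ G z * L z) w = -logDeriv (fun z ↦ G z * L' z) s₀ := by
    rw [logDeriv_apply, logDeriv_apply]
    have e1 : deriv (fun z ↦ G z * L z) w = -deriv F s₀ := by rw [hdF]; ring
    rw [e1, ← hFs, hFH0, hdFH, hdH, hHs]
    field_simp
  rw [logDeriv_mul w hγw0 hLw0 hγw hLw] at hlogΛ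
  rw [logDeriv_mul s₀ hγs0 hL'w hγs hLs0] at hlogΛ
  have hGw := logDeriv_completedGamma p hApos hwZ
  have hGs := logDeriv_completedGamma p hApos hs₀Z
  simp only [hG] at hlogΛ hGw hGs ⊢
  rw [hGw, hGs] at hlogΛ
  linear_combination hlogΛ

/-! ### `L ≠ 0` on `Re s ≥ 1` -/

/-- `L(s) ≠ 0` for `Re s ≥ 1`: the Euler product on `Re s > 1` and Hecke–Landau on `Re s = 1`. [folklore] -/
private theorem continuation_ne_zero_of_one_le_re (h𝔪 : 𝔪 ≠ ⊥) (hψ : IsRayClassCharacter 𝔪 ψ)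
    (hnt : ∃ v : HeightOneSpectrum (𝓞 K), ¬ 𝔪 ≤ v.asIdeal ∧ ψ v ≠ 1)
    {L : ℂ → ℂ} (hL : Differentiable ℂ L) (hLs : ∀ s : ℂ, 1 < s.re → L s = rayClassLSeries 𝔪 ψ s)
    {s : ℂ} (hs : 1 ≤ s.re) : L s ≠ 0 := by
  rcases hs.lt_or_eq with hlt | heq
  · have h := exp_neg_finrank_div_le_norm_rayClassLSeries h𝔪 (fun v hv ↦ (hψ.norm_eq_one v hv).le) hlt
    intro h0
    rw [← hLs _ hlt, h0, norm_zero] at h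
    exact absurd h (not_le.mpr (Real.exp_pos _))
  · exact rayClassLSeries_entire_apply_ne_zero_of_re_eq_one h𝔪 hψ hnt hL hLs heq.symm

/-! ### The strip bound at a good height -/

/-- **`L'/L` on `1/4 ≤ σ ≤ 3/2` at an `η`-separated height**: if every zero of `L` with `0 < β < 1` has
`|γ − t| ≥ η` (`0 < η ≤ 1`), then for `σ ∈ [1/4, 3/2]`: `L(σ + it) ≠ 0` and
`‖L'/L(σ + it)‖ ≤ 78000 · M(t)/η`, `M(t) = log(|d_K|𝔑𝔪) + 3n_K + n_K log(|t|+7)`.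
[cite: MontgomeryVaughan2007, Lemma 12.6] -/
theorem norm_logDeriv_continuation_le_of_dist (hψ : IsRayClassCharacter 𝔪 ψ) (hprim : IsPrimitive 𝔪 ψ)
    (hp : IsSignType 𝔪 ψ p) (h𝔪 : 𝔪 ≠ ⊥)
    (hnt : ∃ v : HeightOneSpectrum (𝓞 K), ¬ 𝔪 ≤ v.asIdeal ∧ ψ v ≠ 1)
    {L : ℂ → ℂ} (hL : Differentiable ℂ L) (hLs : ∀ s : ℂ, 1 < s.re → L s = rayClassLSeries 𝔪 ψ s)
    {t η : ℝ} (hη : 0 < η) (hη1 : η ≤ 1)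
    (hsep : ∀ ρ : ℂ, L ρ = 0 → 0 < ρ.re → ρ.re < 1 → η ≤ |ρ.im - t|)
    {σ : ℝ} (hσ1 : 1 / 4 ≤ σ) (hσ2 : σ ≤ 3 / 2) :
    L (σ + t * I) ≠ 0 ∧
      ‖logDeriv L (σ + t * I)‖ ≤ 78000 * (Real.log (|(discr K : ℝ)| * (Ideal.absNorm 𝔪 : ℝ)) +
        3 * Module.finrank ℚ K + Module.finrank ℚ K * Real.log (|t| + 7)) / η := by
  set ℳ : ℝ := Real.log (|(discr K : ℝ)| * (Ideal.absNorm 𝔪 : ℝ)) + 3 * Module.finrank ℚ K +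
    Module.finrank ℚ K * Real.log (|t| + 7) with hℳ
  set s : ℂ := σ + t * I with hs
  have hsre : s.re = σ := by simp [hs]
  have hsim : s.im = t := by simp [hs]
  have hfc : L (2 + (t : ℂ) * I) ≠ 0 :=
    continuation_ne_zero_of_one_le_re h𝔪 hψ hnt hL hLs (by simp)
  -- zeros in the Jensen disc are non-trivial, hence `η`-separated from `s`
  have hzero_sep : ∀ ρ ∈ discZeros L t, η ≤ ‖s - ρ‖ := by
    intro ρ hρ
    obtain ⟨hmem, h0⟩ := (mem_discZeros hL hfc).1 hρ
    have hre1 : ρ.re < 1 := by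
      by_contra hge; rw [not_lt] at hge
      exact continuation_ne_zero_of_one_le_re h𝔪 hψ hnt hL hLs hge h0
    have hre0 : 0 < ρ.re := by
      rw [mem_closedBall, dist_eq_norm] at hmem
      have := Complex.abs_re_le_norm (ρ - (2 + (t : ℂ) * I))
      simp at this
      have h' : |ρ.re - 2| ≤ 31 / 16 := this.trans hmem
      rw [abs_le] at h'; linarith
    have h1 := hsep ρ h0 hre0 hre1
    calc η ≤ |ρ.im - t| := h1
      _ = |(s - ρ).im| := by rw [Complex.sub_im, hsim, abs_sub_comm]
      _ ≤ ‖s - ρ‖ := Complex.abs_im_le_norm _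
  have hfs : L s ≠ 0 := by
    intro h0
    rcases lt_or_ge σ 1 with hσ | hσ
    · have := hsep s h0 (by rw [hsre]; linarith) (by rw [hsre]; exact hσ)
      rw [hsim, sub_self, abs_zero] at this; linarith
    · exact continuation_ne_zero_of_one_le_re h𝔪 hψ hnt hL hLs (by rw [hsre]; exact hσ) h0
  refine ⟨hfs, ?_⟩
  have hsmem : s ∈ closedBall (2 + (t : ℂ) * I) (7 / 4) := by
    rw [mem_closedBall, dist_eq_norm]
    have : s - (2 + (t : ℂ) * I) = ((σ - 2 : ℝ) : ℂ) := by rw [hs]; push_cast; ring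
    rw [this, Complex.norm_real, Real.norm_eq_abs, abs_le]; constructor <;> linarith
  have hpf : ‖logDeriv L s - ∑ u ∈ discZeros L t, (discDivisor L t u : ℂ) / (s - u)‖ ≤ 77760 * ℳ :=
    norm_logDeriv_continuation_sub_sum_le hψ hprim hp h𝔪 hnt hL hLs t hsmem hfs
  have hJ : ∑ u ∈ discZeros L t, (discDivisor L t u : ℝ) ≤ 32 * ℳ :=
    sum_divisor_continuation_bigDisc_le hψ hprim hp h𝔪 hnt hL hLs t
  have hsum : ‖∑ u ∈ discZeros L t, (discDivisor L t u : ℂ) / (s - u)‖ ≤ 32 * ℳ / η := by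
    calc ‖∑ u ∈ discZeros L t, (discDivisor L t u : ℂ) / (s - u)‖
        ≤ ∑ u ∈ discZeros L t, ‖(discDivisor L t u : ℂ) / (s - u)‖ := norm_sum_le _ _
      _ ≤ ∑ u ∈ discZeros L t, (discDivisor L t u : ℝ) / η := by
          refine sum_le_sum fun u hu ↦ ?_
          have hm0 : (0 : ℝ) ≤ discDivisor L t u := by exact_mod_cast discDivisor_nonneg hL t u
          rw [norm_div, show ‖(discDivisor L t u : ℂ)‖ = (discDivisor L t u : ℝ) by
            rw [show (discDivisor L t u : ℂ) = ((discDivisor L t u : ℝ) : ℂ) by norm_cast, Complex.norm_real,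
              Real.norm_of_nonneg hm0]]
          exact div_le_div_of_nonneg_left hm0 hη (hzero_sep u hu)
      _ = (∑ u ∈ discZeros L t, (discDivisor L t u : ℝ)) / η := by rw [sum_div]
      _ ≤ 32 * ℳ / η := div_le_div_of_nonneg_right hJ hη.le
  have hℳ0 : 0 ≤ ℳ := by
    have hJ0 : 0 ≤ ∑ u ∈ discZeros L t, (discDivisor L t u : ℝ) :=
      sum_nonneg fun u _ ↦ by exact_mod_cast discDivisor_nonneg hL t u
    linarith
  calc ‖logDeriv L s‖ ≤ ‖logDeriv L s - ∑ u ∈ discZeros L t, (discDivisor L t u : ℂ) / (s - u)‖ +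
        ‖∑ u ∈ discZeros L t, (discDivisor L t u : ℂ) / (s - u)‖ := norm_le_norm_sub_add _ _
    _ ≤ 77760 * ℳ + 32 * ℳ / η := add_le_add hpf hsum
    _ ≤ 77760 * ℳ / η + 32 * ℳ / η := by
        refine add_le_add ?_ le_rfl
        rw [le_div_iff₀ hη]
        exact mul_le_of_le_one_right (by positivity) hη1
    _ ≤ 78000 * ℳ / η := by
        rw [← add_div]
        refine div_le_div_of_nonneg_right ?_ hη.le
        nlinarith

/-- **`L'/L(σ + it)` on the whole strip `−1/2 ≤ σ ≤ 3/2` at a doubly good height**, uniformly in the field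
and the modulus (`|t| ≥ 2`, `0 < η ≤ 1`): if the zeros of `L` with `0 < β < 1` are `η`-separated from `t` and
those of `L̄` from `−t`, then `L(σ + it) ≠ 0` and `‖L'/L(σ + it)‖ ≤ 80000 · M(t)/η`.
[cite: MontgomeryVaughan2007, Lemma 12.8] [cite: LagariasOdlyzko1977, Lemma 5.6] -/
theorem norm_logDeriv_continuation_le_strip (hψ : IsRayClassCharacter 𝔪 ψ) (hprim : IsPrimitive 𝔪 ψ)
    (hp : IsSignType 𝔪 ψ p) (h𝔪 : 𝔪 ≠ ⊥)
    (hnt : ∃ v : HeightOneSpectrum (𝓞 K), ¬ 𝔪 ≤ v.asIdeal ∧ ψ v ≠ 1)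
    {L L' : ℂ → ℂ} (hL : Differentiable ℂ L) (hLs : ∀ s : ℂ, 1 < s.re → L s = rayClassLSeries 𝔪 ψ s)
    (hL' : Differentiable ℂ L') (hL's : ∀ s : ℂ, 1 < s.re → L' s = rayClassLSeries 𝔪 (star ψ) s)
    {t η : ℝ} (ht : 2 ≤ |t|) (hη : 0 < η) (hη1 : η ≤ 1)
    (hsep : ∀ ρ : ℂ, L ρ = 0 → 0 < ρ.re → ρ.re < 1 → η ≤ |ρ.im - t|)
    (hsep' : ∀ ρ : ℂ, L' ρ = 0 → 0 < ρ.re → ρ.re < 1 → η ≤ |ρ.im - -t|)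
    {σ : ℝ} (hσ1 : -(1 / 2) ≤ σ) (hσ2 : σ ≤ 3 / 2) :
    L (σ + t * I) ≠ 0 ∧
      ‖logDeriv L (σ + t * I)‖ ≤ 80000 * (Real.log (|(discr K : ℝ)| * (Ideal.absNorm 𝔪 : ℝ)) +
        3 * Module.finrank ℚ K + Module.finrank ℚ K * Real.log (|t| + 7)) / η := by
  set A : ℝ := |(discr K : ℝ)| * (Ideal.absNorm 𝔪 : ℝ) with hA
  set n : ℕ := Module.finrank ℚ K with hn
  set ℳ : ℝ := Real.log A + 3 * n + n * Real.log (|t| + 7) with hℳ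
  have hA1 : 1 ≤ A := by
    have h1 : (1 : ℝ) ≤ |(discr K : ℝ)| := by
      have := Int.one_le_abs (discr_ne_zero K)
      rw [← Int.cast_abs]; exact_mod_cast this
    have h2 : (1 : ℝ) ≤ (Ideal.absNorm 𝔪 : ℝ) := by
      exact_mod_cast Nat.one_le_iff_ne_zero.mpr (by rwa [ne_eq, Ideal.absNorm_eq_zero_iff])
    rw [hA]; nlinarith
  have hlogA : 0 ≤ Real.log A := Real.log_nonneg hA1
  have hn0 : (0 : ℝ) ≤ n := Nat.cast_nonneg _
  have hl7 : 0 ≤ Real.log (|t| + 7) := Real.log_nonneg (by linarith [abs_nonneg t])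
  have hl47 : Real.log (|t| + 4) ≤ Real.log (|t| + 7) :=
    Real.log_le_log (by linarith [abs_nonneg t]) (by linarith)
  have hℳ0 : 0 ≤ ℳ := by rw [hℳ]; positivity
  by_cases hσ : 1 / 4 ≤ σ
  · obtain ⟨h0, hb⟩ := norm_logDeriv_continuation_le_of_dist hψ hprim hp h𝔪 hnt hL hLs hη hη1 hsep hσ hσ2
    refine ⟨h0, hb.trans ?_⟩
    exact div_le_div_of_nonneg_right (by nlinarith) hη.le
  rw [not_le] at hσ
  set w : ℂ := σ + t * I with hw
  have ht0 : t ≠ 0 := fun h ↦ by rw [h, abs_zero] at ht; linarith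
  have hwZ : ∀ k : ℤ, w ≠ k := NumberField.ne_int_of_im_ne_zero (by simpa [hw] using ht0)
  have e1w : 1 - w = ((1 - σ : ℝ) : ℂ) + ((-t : ℝ) : ℂ) * I := by rw [hw]; push_cast; ring
  -- the reflected point for `L̄`
  obtain ⟨hL'0, hL'b⟩ := norm_logDeriv_continuation_le_of_dist hψ.star hprim.star hp.star h𝔪
    (star_nontrivial' hnt) hL' hL's (t := -t) hη hη1 hsep' (σ := 1 - σ) (by linarith) (by linarith)
  rw [abs_neg, ← e1w] at hL'b
  rw [← e1w] at hL'0
  obtain ⟨hLw0, hrefl⟩ := logDeriv_continuation_reflect hψ hprim hp h𝔪 hL hLs hL' hL's hwZ hL'0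
  refine ⟨hLw0, ?_⟩
  -- the gamma factors
  have hγ1 : ‖logDeriv (rayClassGammaFactor K p) w‖ ≤ n * (Real.log (|t| + 4) + 11) :=
    norm_logDeriv_rayClassGammaFactor_le p hσ1 hσ2 ht
  have hγ2 : ‖logDeriv (rayClassGammaFactor K p) (1 - w)‖ ≤ n * (Real.log (|t| + 4) + 11) := by
    have h := norm_logDeriv_rayClassGammaFactor_le (K := K) p (σ := 1 - σ) (t := -t) (by linarith) (by linarith)
      (by rwa [abs_neg])
    rwa [abs_neg, ← e1w] at h
  have hlogAn : ‖(-(Real.log A : ℂ))‖ = Real.log A := by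
    rw [norm_neg, Complex.norm_real, Real.norm_of_nonneg hlogA]
  rw [hrefl]
  calc ‖-(Real.log A : ℂ) - logDeriv (rayClassGammaFactor K p) w - logDeriv (rayClassGammaFactor K p) (1 - w) -
        logDeriv L' (1 - w)‖
      ≤ ‖-(Real.log A : ℂ)‖ + ‖logDeriv (rayClassGammaFactor K p) w‖ +
          ‖logDeriv (rayClassGammaFactor K p) (1 - w)‖ + ‖logDeriv L' (1 - w)‖ := by
        refine (norm_sub_le _ _).trans (add_le_add ((norm_sub_le _ _).trans (add_le_add (norm_sub_le _ _) le_rfl))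
          le_rfl)
    _ ≤ Real.log A + n * (Real.log (|t| + 4) + 11) + n * (Real.log (|t| + 4) + 11) + 78000 * ℳ / η := by
        rw [hlogAn]; gcongr
    _ ≤ 8 * ℳ + 78000 * ℳ / η := by
        refine add_le_add ?_ le_rfl
        rw [hℳ]; nlinarith
    _ ≤ 8 * ℳ / η + 78000 * ℳ / η := by
        refine add_le_add ?_ le_rfl
        rw [le_div_iff₀ hη]
        exact mul_le_of_le_one_right (by positivity) hη1
    _ ≤ 80000 * ℳ / η := by
        rw [← add_div]
        refine div_le_div_of_nonneg_right ?_ hη.le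
        nlinarith

end Literature.NumberTheory.LFunctions
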